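import Literature.NumberTheory.LocalFields.BinomialTwistOfNodeValues
import Literature.NumberTheory.LocalFields.BinomialTwistExponentPadicIntegral
import Mathlib.Tactic
import HarnessLib

/-!
# Node-proportional values of two `p`-integral power series of unit content: the twist is a UNIT
# binomial power `c'·(1+X)^z`, `z ∈ ℤ_p`, `‖c'‖ = 1` (Gouvêa §5.9; Robert V.2.4, VI.2.1)

Topic `NumberTheory/LocalFields`; namespace `Literature.NumberTheory.LocalFields`. Everything here is
proved (theorems only; no definitions, no named facts). Assembly of
`BinomialTwistOfNodeValues` (analytic step: `(1+X)(fg′ − gf′) = e·fg`),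
`BinomialSeriesDifferentialEquation` (`g = Q·f`, `(1+X)Q′ = eQ`) and
`BinomialTwistExponentPadicIntegral` / `BinomialCoefficientsPadicIntegral` (`e ∈ ℤ_p`).

SETTING. `K` a complete normed `ℚ_p`-algebra (`ℚ_p`, finite extensions, `ℂ_p`); `f, g ∈ K⟦X⟧` with
coefficients of norm `≤ 1` and EACH with a coefficient of norm `1` (unit content); `u` a one-unit
which is not a root of unity (nodes `y_t = uᵗ − 1`); `c, d ≠ 0` with `g(y_t) = c·dᵗ·f(y_t)` for all
`t ∈ ℕ`, and one `f(y_{t₀}) ≠ 0`.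

* **`exists_padicInt_binomial_twist_of_node_values`** — there are `z ∈ ℤ_p` and `Q ∈ K⟦X⟧` with
  `g = Q·f` and `(1 + X)·Q′ = z·Q` (so `n!·[Xⁿ]Q = Q(0)·z(z−1)⋯(z−n+1)`: `Q = Q(0)·(1+X)^z`).
* `norm_coeff_le_norm_constantCoeff_of_ode_padicInt` — a solution of `(1+X)Q′ = zQ` with `z ∈ ℤ_p`
  has `‖[Xⁿ]Q‖ ≤ ‖Q(0)‖` (Gouvêa's Lemma 5.9.1: `C(z,n) ∈ ℤ_p`).
* **`norm_constantCoeff_eq_one_of_binomial_twist`** — in the setting, `‖Q(0)‖ = 1`: the twist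
  `Q = Q(0)·(1+X)^z` is a UNIT of the integral power series (a unit Iwasawa function). Hence
  (`norm_coeff_le_one_of_binomial_twist`) `Q` itself has coefficients of norm `≤ 1`.

Use (the reason this was written; cell `bsd`, K6 frame currency): two Katz–de Shalit frames of the
same datum at different period data, read on a `ℤ_p`-line, have node values proportional by
`c·dᵗ`; by this file they differ by a unit binomial twist, so every invariant read through units
of `𝒪⟦X⟧` (`λ̄`, `μ`, unit content, the first unit coefficient) is independent of the periods.
Not here: the identification `d = u^z` of the ratio itself (it needs the base-multiplicativity of
the binomial power, `(uv)^z = u^z v^z`, not yet in the tree for a general `K`).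

## References

* F. Q. Gouvêa, *p-adic Numbers: An Introduction*, Universitext, Springer 1993, §5.9 Lemma 5.9.1
  and Problem 194 (held text pp. 131–132). [Gouvea1993PadicNumbers]
* A. M. Robert, *A Course in p-adic Analysis*, GTM 198, Springer 2000, Ch. V §2.4 Theorem 1;
  Ch. VI §2.1 (Strassman). [Robert2000PadicAnalysis]
-/

noncomputable section

open Finset Filter PowerSeries

namespace Literature.NumberTheory.LocalFields

variable {p : ℕ} {K : Type*} [NontriviallyNormedField K] [IsUltrametricDist K]

section PadicInt

variable [hp : Fact p.Prime] [instK : NormedAlgebra ℚ_[p] K]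

omit [IsUltrametricDist K] in
/-- **A solution of `(1+X)Q′ = zQ` with `z ∈ ℤ_p` has `‖[Xⁿ]Q‖ ≤ ‖Q(0)‖`** (`n!·[Xⁿ]Q =
Q(0)·z(z−1)⋯(z−n+1)` and Gouvêa's Lemma 5.9.1 `‖z(z−1)⋯(z−n+1)‖ ≤ ‖n!‖`).
[cite: Gouvea1993PadicNumbers, §5.9 Lemma 5.9.1] -/
theorem norm_coeff_le_norm_constantCoeff_of_ode_padicInt {Q : K⟦X⟧} {z : ℤ_[p]}
    (hQ : (1 + X) * derivative K Q = C (algebraMap ℚ_[p] K (z : ℚ_[p])) * Q) (n : ℕ) :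
    ‖coeff n Q‖ ≤ ‖constantCoeff Q‖ := by
  have : CharZero K := charZero_of_injective_algebraMap (algebraMap ℚ_[p] K).injective
  have hfact := coeff_mul_factorial_of_ode hQ n
  have hn : (n.factorial : K) ≠ 0 := by exact_mod_cast Nat.factorial_ne_zero n
  have hn' : 0 < ‖(n.factorial : K)‖ := norm_pos_iff.2 hn
  have hP := norm_descPochhammer_le_of_padicInt (F := K) (p := p) z n
  have h1 : ‖(n.factorial : K)‖ * ‖coeff n Q‖ ≤ ‖constantCoeff Q‖ * ‖(n.factorial : K)‖ := by
    rw [← norm_mul, hfact, norm_mul]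
    exact mul_le_mul_of_nonneg_left hP (norm_nonneg _)
  nlinarith

variable [CompleteSpace K]
include hp instK

/-- **Node-proportional values ⟹ a binomial twist with exponent in `ℤ_p`.** In the setting of the
module docstring there are `z ∈ ℤ_p` and `Q` with `g = Q·f` and `(1 + X)·Q′ = z·Q` (so
`Q = Q(0)·(1+X)^z`: `n!·[Xⁿ]Q = Q(0)·z(z−1)⋯(z−n+1)`, `coeff_mul_factorial_of_ode`).
[cite: Gouvea1993PadicNumbers, §5.9 Lemma 5.9.1 (converse) and Problem 194]
[cite: Robert2000PadicAnalysis, Ch. V §2.4 Theorem 1; Ch. VI §2.1 Theorem (Strassman)] -/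
theorem exists_padicInt_binomial_twist_of_node_values {f g : K⟦X⟧} (hf : ∀ n, ‖coeff n f‖ ≤ 1)
    (hg : ∀ n, ‖coeff n g‖ ≤ 1) (hfu : ∃ n, ‖coeff n f‖ = 1) (hgu : ∃ n, ‖coeff n g‖ = 1)
    {u c d : K} (hu : ‖u - 1‖ < 1) (hroot : ∀ n : ℕ, 0 < n → u ^ n ≠ 1) (hc : c ≠ 0) (hd : d ≠ 0)
    (hrel : ∀ t : ℕ, ∑' n, coeff n g * (u ^ t - 1) ^ n = c * d ^ t * ∑' n, coeff n f * (u ^ t - 1) ^ n)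
    {t₀ : ℕ} (h0 : ∑' n, coeff n f * (u ^ t₀ - 1) ^ n ≠ 0) :
    ∃ (z : ℤ_[p]) (Q : K⟦X⟧), g = Q * f ∧
      (1 + X) * derivative K Q = C (algebraMap ℚ_[p] K (z : ℚ_[p])) * Q := by
  have : CharZero K := charZero_of_injective_algebraMap (algebraMap ℚ_[p] K).injective
  obtain ⟨e, he⟩ := exists_wronskian_eq_of_node_values (p := p) hf hg hu hroot hc hd hrel h0
  have hf0 : f ≠ 0 := by
    intro h; apply h0; simp [h]
  obtain ⟨Q, hgQ, hQ⟩ := exists_ode_of_wronskian hf0 he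
  obtain ⟨z, hz⟩ := exists_padicInt_eq_of_binomial_twist' (p := p) hQ hgQ hf hg hfu hgu
  exact ⟨z, Q, hgQ, by rw [hz]; exact hQ⟩

omit [CompleteSpace K] in
/-- **The twist constant is a unit**: if `g = Q·f` with `(1+X)Q′ = zQ`, `z ∈ ℤ_p`, `f, g` with
coefficients of norm `≤ 1` and each with a coefficient of norm `1`, then `‖Q(0)‖ = 1` — so
`Q = Q(0)·(1+X)^z` is a unit of the integral power series. [cite: Gouvea1993PadicNumbers, §5.9 Lemma 5.9.1 and Thm. 7.2.1 (iii) (proof)] -/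
theorem norm_constantCoeff_eq_one_of_binomial_twist {f g Q : K⟦X⟧} {z : ℤ_[p]}
    (hf : ∀ n, ‖coeff n f‖ ≤ 1) (hg : ∀ n, ‖coeff n g‖ ≤ 1) (hfu : ∃ n, ‖coeff n f‖ = 1)
    (hgu : ∃ n, ‖coeff n g‖ = 1) (hgQ : g = Q * f)
    (hQ : (1 + X) * derivative K Q = C (algebraMap ℚ_[p] K (z : ℚ_[p])) * Q) :
    ‖constantCoeff Q‖ = 1 := by
  have hQle := norm_coeff_le_norm_constantCoeff_of_ode_padicInt (p := p) hQ
  refine le_antisymm ?_ ?_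
  · -- `‖Q(0)‖ ≤ 1`: the first unit coefficient of `f`, in degree `N`, gives `‖[X^N]g‖ = ‖Q(0)‖`
    classical
    by_contra hlt
    push Not at hlt
    have hQ0 : constantCoeff Q ≠ 0 := fun h ↦ by rw [h, norm_zero] at hlt; exact not_lt.2 zero_le_one hlt
    set N := Nat.find hfu with hN
    have hNu : ‖coeff N f‖ = 1 := Nat.find_spec hfu
    have hNlt : ∀ n < N, ‖coeff n f‖ < 1 := fun n hn ↦ lt_of_le_of_ne (hf n) (Nat.find_min hfu hn)
    -- normalise `Q`: `Q₁ = Q(0)⁻¹·Q` has constant term `1` and coefficients of norm `≤ 1`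
    set Q₁ : K⟦X⟧ := C (constantCoeff Q)⁻¹ * Q with hQ₁
    have hQ₁i : ∀ n, ‖coeff n Q₁‖ ≤ 1 := fun n ↦ by
      rw [hQ₁, coeff_C_mul, norm_mul, norm_inv]
      exact (inv_mul_le_iff₀ (norm_pos_iff.2 hQ0)).2 (by rw [mul_one]; exact hQle n)
    have hQ₁0 : ‖coeff 0 Q₁‖ = 1 := by
      rw [hQ₁, coeff_C_mul, coeff_zero_eq_constantCoeff, inv_mul_cancel₀ hQ0, norm_one]
    have hprod := norm_coeff_mul_eq_one_of_first_unit hQ₁i hf hQ₁0 (fun n hn ↦ absurd hn (Nat.not_lt_zero n))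
      hNu hNlt
    rw [zero_add] at hprod
    have hgN : coeff N g = constantCoeff Q * coeff N (Q₁ * f) := by
      rw [hgQ, hQ₁, mul_assoc, coeff_C_mul, ← mul_assoc, mul_inv_cancel₀ hQ0, one_mul]
    have := hg N
    rw [hgN, norm_mul, hprod, mul_one] at this
    exact not_lt.2 this hlt
  · -- `1 ≤ ‖Q(0)‖`: a unit coefficient of `g = Q·f` is a sum of products `Q_i f_j`
    obtain ⟨M, hM⟩ := hgu
    rw [hgQ, coeff_mul] at hM
    by_contra hlt
    push Not at hlt
    have hbound : ‖∑ ij ∈ antidiagonal M, coeff ij.1 Q * coeff ij.2 f‖ < 1 := by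
      rcases (antidiagonal M).eq_empty_or_nonempty with he | hne
      · rw [he, sum_empty, norm_zero]; exact one_pos
      refine (hne.norm_sum_le_sup'_norm _).trans_lt ((Finset.sup'_lt_iff hne).2 fun ij _ ↦ ?_)
      rw [norm_mul]
      calc ‖coeff ij.1 Q‖ * ‖coeff ij.2 f‖ ≤ ‖constantCoeff Q‖ * 1 :=
            mul_le_mul (hQle _) (hf _) (norm_nonneg _) (norm_nonneg _)
        _ < 1 := by rw [mul_one]; exact hlt
    rw [hM] at hbound
    exact lt_irrefl _ hbound

omit [CompleteSpace K] in
/-- Hence the twist `Q` itself has coefficients of norm `≤ 1` (a unit of the integral power series: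
`‖Q(0)‖ = 1`, `‖[Xⁿ]Q‖ ≤ 1`). [cite: Gouvea1993PadicNumbers, §5.9 Lemma 5.9.1] -/
theorem norm_coeff_le_one_of_binomial_twist {f g Q : K⟦X⟧} {z : ℤ_[p]}
    (hf : ∀ n, ‖coeff n f‖ ≤ 1) (hg : ∀ n, ‖coeff n g‖ ≤ 1) (hfu : ∃ n, ‖coeff n f‖ = 1)
    (hgu : ∃ n, ‖coeff n g‖ = 1) (hgQ : g = Q * f)
    (hQ : (1 + X) * derivative K Q = C (algebraMap ℚ_[p] K (z : ℚ_[p])) * Q) (n : ℕ) :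
    ‖coeff n Q‖ ≤ 1 := by
  rw [← norm_constantCoeff_eq_one_of_binomial_twist (p := p) hf hg hfu hgu hgQ hQ]
  exact norm_coeff_le_norm_constantCoeff_of_ode_padicInt (p := p) hQ n

end PadicInt

end Literature.NumberTheory.LocalFields
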